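/-
Origin: expansion seat `planner-pub-hodgecm-pv06-g7-0`, handover #6 (CLAIM 2026-08-18T15:39:41Z; HANDOVER #6 2026-08-18T15:50:36Z) md5 32b78b93fff94cbde69d3c0ba08084b6 (90 l., 4 decls); additive KERNEL leaf (node N29 / seam S4: the pv14-g6 <-> pv06-g7 junction: flowGen_hypVelE_hermiteSchwartz(_binv), tendsto_hermiteSchwartz_comp_hypRotE_sub_div = the Schwartz-topology smooth-vector clause ((s:C))^-1 (hermiteSchwartz p o hypRotE s - hermiteSchwartz p) -> hermite (`HOME/pub-hodgecm-pv06-g7/lean/Pv06g7/ArchCHyperbolicJunction.lean`, md5 32b78b93, 90 lines);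
landed by the gen-8 packager in gate run 31 as `HodgeCM/PerL34/ArchCHyperbolicJunction.lean` (import ^import Pv06g7\.ArchCHyperbolicSchwartz[ \t]*$→import HodgeCM.PerL34.ArchCHyperbolicSchwartz ×1).
-/
/-
Copyright (c) 2026. Released under the Apache-2.0 license.
-/
import Summits.HodgeConjecture.HodgeCM.PerL34.ArchCHyperbolicSchwartz
import Summits.HodgeConjecture.HodgeCM.Automorphic.SchwartzInvolFlowTransport

/-!
# The Σ₁₂ smooth-vector clause for the Hermite–Schwartz functions along the hyperbolic flow (node N29, seam S4)

Origin: expansion seat `planner-pub-hodgecm-pv06-g7-0` (unit `pub-hodgecm-pv06-g7`, DAG-node prover #06 gen 7).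
WIP module `Pv06g7.ArchCHyperbolicJunction`; intended final place `HodgeCM/PerL34/ArchCHyperbolicJunction.lean`.
Imports: this seat's row #5 `Pv06g7.ArchCHyperbolicSchwartz` (↦ `HodgeCM.PerL34.ArchCHyperbolicSchwartz`, ONE
rewrite) and — CROSS-SEAT, SAME RUN 31 — pv14-g6's row #27 under its TREE name
`HodgeCM.Automorphic.SchwartzInvolFlowTransport` (`SchwartzWeil.tendsto_compCLM_sub_div_ofReal_of_coe_eq`,
`flowGen`, `flowGen_apply`; itself importing pv14-g6 #25 `SchwartzHyperbolicFlow`).  HOLD this file iff either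
parent is held.  Additive kernel leaf: asserts nothing, complete proofs, nothing cited enters as a hypothesis.

## What is proved (KERNEL) — the junction pv14-g6 ⟷ pv06-g7 in three lines

* `flowGen_hypVelE_hermiteSchwartz : flowGen hypVelE (hermiteSchwartz p) = hermiteSchwartz (hypSymb p)` and
  `flowGen_hypVelE_hermiteSchwartz_binv : flowGen hypVelE (hermiteSchwartz (binv F)) = hermiteSchwartz (binv (printedHyp lamF F))`
  (pv14-g6's 𝒮-generator of the linear flow with velocity field `hypVelE`, evaluated on pv05's Hermite-span
  functions packaged in `𝓢(E6, ℂ)` by row #5; `flowGen_apply` is `rfl`, the derivative is row #5's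
  `fderiv_hermiteSchwartz_hypVelE`).
* **`tendsto_hermiteSchwartz_comp_hypRotE_sub_div`**: for every polynomial `p`,
  `((s : ℂ))⁻¹ • (hermiteSchwartz p ∘ hypRotE s − hermiteSchwartz p) ⟶ hermiteSchwartz (hypSymb p)` in the
  SCHWARTZ TOPOLOGY as `s → 0`, `s ≠ 0` (pv14-g6 #27 `tendsto_compCLM_sub_div_ofReal_of_coe_eq` fed with row #5's
  `hypVelE_mul_self : hypVelE² = 1` and `hypRotE_eq_cosh_add_sinh : ↑(hypRotE s) = cosh s • 1 + sinh s • hypVelE`).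
* **`tendsto_hermiteSchwartz_binv_comp_hypRotE_sub_div`**: on the Schrödinger images `hermiteSchwartz (binv F)` of
  the Fock polynomials `F ∈ ℂ[z_a, w_a]` the limit is `hermiteSchwartz (binv (printedHyp lamF F))` — pv12's printed
  Fock operator of `X₁ = E₀₁ + E₁₀` at Folland's scaling, through pv05's Bargmann dictionary (row #2).

This is the literal shape of the `smooth` clause of `ArchC.HypSmoothSide` (row #1b) at a Σ₁₂ place for the
composition flow `Φ ↦ Φ ∘ hypRotE s` on `𝓢(E6, ℂ)`, `E6 = EuclideanSpace ℝ MixedVar ≅ ℝ³ × ℝ³`.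
Labels.  KERNEL: everything below.  Not done here (honest): the model identification of the CONSTRUCTED `ω(exp sX₁)`
with `Φ ↦ Φ ∘ hypRotE (±s)` on the image of `ins` ([SETUP D4]) and the five algebraic 𝒯-free fields of
`HypSmoothSide`.  PerL / QW8 / 2001 texts are NOT cited.
-/

set_option autoImplicit false

noncomputable section

namespace HodgeCM
namespace PerL34
namespace Fock
namespace PrintDict

open Filter Topology MvPolynomial
open HodgeCM.PerL34.Fock.Hermite HodgeCM.SchwartzWeil

/-- pv14-g6's 𝒮-generator along `hypVelE` on the Hermite–Schwartz functions is the symbol map `hypSymb`. -/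
theorem flowGen_hypVelE_hermiteSchwartz (p : MvPolynomial MixedVar ℂ) :
    flowGen hypVelE (hermiteSchwartz p) = hermiteSchwartz (hypSymb p) := by
  ext x
  rw [flowGen_apply, fderiv_hermiteSchwartz_hypVelE]

/-- The same through the Bargmann dictionary: the generator is `binv ∘ printedHyp lamF`. -/
theorem flowGen_hypVelE_hermiteSchwartz_binv (F : MixedModel) :
    flowGen hypVelE (hermiteSchwartz (binv F)) = hermiteSchwartz (binv (printedHyp lamF F)) := by
  ext x
  rw [flowGen_apply, fderiv_hermiteSchwartz_binv_hypVelE]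

/-- **The Σ₁₂ smooth-vector clause in the Schwartz topology (KERNEL)**: for every polynomial `p`,
`((s : ℂ))⁻¹ • (hermiteSchwartz p ∘ hypRotE s − hermiteSchwartz p) → hermiteSchwartz (hypSymb p)` as `s → 0`,
`s ≠ 0`, in `𝓢(E6, ℂ)`. -/
theorem tendsto_hermiteSchwartz_comp_hypRotE_sub_div (p : MvPolynomial MixedVar ℂ) :
    Tendsto (fun s : ℝ => ((s : ℂ))⁻¹ •
        (SchwartzMap.compCLMOfContinuousLinearEquiv ℂ (hypRotE s) (hermiteSchwartz p) - hermiteSchwartz p))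
      (𝓝[≠] 0) (𝓝 (hermiteSchwartz (hypSymb p))) := by
  have h := tendsto_compCLM_sub_div_ofReal_of_coe_eq hypVelE_mul_self hypRotE_eq_cosh_add_sinh (hermiteSchwartz p)
  rwa [flowGen_hypVelE_hermiteSchwartz] at h

/-- **On the Schrödinger images of the Fock polynomials (KERNEL)**: the Schwartz-topology derivative at `s = 0` of
`s ↦ hermiteSchwartz (binv F) ∘ hypRotE s` is `hermiteSchwartz (binv (printedHyp lamF F))` — the printed Fock
operator of the hyperbolic direction `X₁`, transported by pv05's Bargmann dictionary. -/
theorem tendsto_hermiteSchwartz_binv_comp_hypRotE_sub_div (F : MixedModel) :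
    Tendsto (fun s : ℝ => ((s : ℂ))⁻¹ •
        (SchwartzMap.compCLMOfContinuousLinearEquiv ℂ (hypRotE s) (hermiteSchwartz (binv F))
          - hermiteSchwartz (binv F)))
      (𝓝[≠] 0) (𝓝 (hermiteSchwartz (binv (printedHyp lamF F)))) := by
  have h := tendsto_hermiteSchwartz_comp_hypRotE_sub_div (binv F)
  rwa [← binv_printedHyp] at h

end PrintDict
end Fock
end PerL34
end HodgeCM

end
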